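import Summits.Ventures.LatticeQCDFlow.Scaling.SwapAcceptanceLadder
import Summits.Ventures.LatticeQCDFlow.TrivializingMaps.ReweightingStepLawAnyGroup
import Summits.Ventures.LatticeQCDFlow.TrivializingMaps.AnnealingAnyGroup
import Summits.Ventures.LatticeQCDFlow.TrivializingMaps.WilsonVarianceFloorAllCouplings
import Summits.Ventures.LatticeQCDFlow.TrivializingMaps.MeanActionFloorSUN

/-!
HONEST FRAMING: exact (Metropolis-corrected) sampling algorithms for lattice gauge theory; figures
of merit are autocorrelation/cost numbers at stated couplings and volumes; no continuum-physics
claim.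

# CouplingLadderLawAnyGroup — PARALLEL TEMPERING IN THE COUPLING: THE SWAP ACCEPTANCE BETWEEN WILSON
# MEASURES AT COUPLINGS `a < b` IS AT MOST `exp(−m(b−a)²/4)` UNDER A SPECIFIC-HEAT FLOOR `m` AND AT LEAST
# `exp(−((b−a)√(2M) + M(b−a)²))` UNDER A CEILING `M`; A REPLICA LADDER FROM `a` TO `b` WITH ADJACENT SWAP
# RATES `≥ α` NEEDS `Θ((b−a)·√#plaq)` REPLICAS — EVERY COMPACT GAUGE GROUP, EVERY VOLUME (lean-2 GEN-11, ours)

Venture-side (OURS).  Cell `lqcd-flow` (pub-lqcd), unit `pub-lqcd-lean-2-g11`, 2026-08-23.  The Wilson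
docking of `Scaling/SwapAcceptanceLaw` (abstract exponential family): `X = −S_W^ρ`, `μ = D[U]`
(`trivialMeasure`), `μ_u = wilsonMeasure ρ u` (`wilsonMeasure_eq_tilted_neg`), `ψ = cgf(−S_W^ρ)`,
`ψ′ = −⟨S_W⟩`, `ψ″ = Var(S_W)`; `G` any compact second-countable group, `ρ` continuous.

* §1 `wilson_swapAcc_eq` — `swapAcc (−S_W) D[U] a b = ∫∫ min(1, e^{(b−a)(S_W(V) − S_W(U))}) dμ_a(U) dμ_b(V)`:
  the stationary mean acceptance of the replica-exchange swap between the couplings `a` and `b` (the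
  swap is exact: `Exactness/PTBCSwap.lean` with `S₁ = a·S_W`, `S₂ = b·S_W`), equivalently of independence
  Metropolis with target `μ_b` and proposal `μ_a`.
* §2 THE TWO-SIDED LAW, every compact `G`, every `L`, all real `a ≤ b`:
  `exp(−(b−a)·√(Var_a + Var_b + (⟨S⟩_a − ⟨S⟩_b)²)) ≤ swapAcc ≤ exp(−(ψ(b) − 2ψ((a+b)/2) + ψ(a)))`
  (`wilson_swapAcc_ge`, `wilson_swapAcc_le`); the ceiling is `1/E_{μ_a}[w²]` for the exact reweighting
  HALF-step `a → (a+b)/2` (`wilson_swapAcc_mul_weight_sq_le_one`: SWAP ACCEPTANCE × REWEIGHTING WEIGHT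
  SECOND MOMENT ≤ 1); under a floor `m ≤ Var_u(S_W)` on `[a,b]`: `swapAcc ≤ exp(−m(b−a)²/4)`; under a
  ceiling `Var_u ≤ M`: `swapAcc ≥ exp(−((b−a)√(2M) + M(b−a)²))` (`wilson_swapAcc_le_of_floor`,
  `wilson_swapAcc_ge_of_ceiling`).
* §3 REPLICA-LADDER LAWS FOR THE WILSON ACTION:
  - **every coupling, every compact `G`** (unitary `ρ`, `d ≥ 2`, `L ≥ 2`, ladder inside `[−B, B]`):
    `e^{−Bc}·⌊L/2⌋^d·Var_Haar(Re tr ρ)·(β_K − β_0)² ≤ 4K²·log(1/α)` (`wilson_ladder_necessary_allCouplings`,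
    GEN-9's floor): **`√volume` replicas are NECESSARY at every coupling**; and (any `ρ`, any `d`, `L`) the
    trivial ceiling `Var ≤ (N#plaq)²` makes `⌈(b−a)·N#plaq·max(1,3/log(1/α))⌉` uniform replicas SUFFICIENT
    (`wilson_ladder_sufficient_allCouplings`): `√volume ≲ K ≲ volume` unconditionally;
  - **strong coupling, two-sided** (window `|u| ≤ min(r/8, v_ρr³/512)` floor `v_ρ#plaq/2`; `|u| ≤ r/4`
    ceiling `32#plaq/r²`): `(v_ρ#plaq/2)(β_K − β_0)² ≤ 4K² log(1/α)` for EVERY ladder, and the uniform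
    ladder with `δ√(32#plaq/r²) ≤ min(1, log(1/α)/3)` has all adjacent rates `≥ α`
    (`wilson_ladder_necessary_strongCoupling`, `wilson_ladder_sufficient_strongCoupling`): **`Θ((b−a)√#plaq)`
    replicas**;
  - **`SU(n)`, polynomial constants** (`n ≥ 2`, `d ≥ 2`, `0 ≤ β_0`): one `c(n,d) > 0` with
    `c·#plaq/(1+β_K²)·(β_K − β_0)² ≤ 4K² log(1/α)` for every `L ≥ 2` (`wilson_ladder_necessary_sun`, item
    129's floor).

Literature grade (cell rule): KNOWN MECHANISM (the `√N`/`√C_V` replica-spacing rule of parallel tempering —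
Hukushima–Nemoto 1996, Kofke 2002, Predescu–Predescu–Ciobanu 2004; Katzgraber arXiv:0905.1629 p. 21), NEW
TYPING for lattice gauge theory with rigorous two-sided constants uniform in the volume.  NOT CLAIMED: a
`√volume` sufficiency outside the strong-coupling window (no variance ceiling of order `#plaq` is in the tree
there — only the trivial `(N#plaq)²`);
round-trip or autocorrelation times of the tempering process; tempering in boundary conditions (the same
abstract law applies to the defect family — docked separately); the continuum.
-/

noncomputable section

open MeasureTheory ProbabilityTheory Real Set
open Literature.MathematicalPhysics.QuantumFieldTheory
open Literature.MathematicalPhysics.QuantumFieldTheory.Luscher2010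
open Summit.Ventures.LatticeQCDFlow.Scaling
open scoped Matrix Matrix.Norms.Frobenius ContDiff

namespace Summit.Ventures.LatticeQCDFlow.TrivializingMaps

/-! ## §1 Dictionary and the reading of `swapAcc (−S_W) D[U]` -/

section AnyGroup

variable {d L N : ℕ} [NeZero L] {G : Type*} [Group G] [TopologicalSpace G] [IsTopologicalGroup G]
  [CompactSpace G] [MeasurableSpace G] [BorelSpace G] [SecondCountableTopology G]
  (ρ : G →* Matrix (Fin N) (Fin N) ℂ)

omit [CompactSpace G] in
/-- `−S_W^ρ` is measurable. [folklore] -/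
theorem measurable_neg_wilsonAction (hρ : Continuous ρ) :
    Measurable fun U : GaugeConfig d L G => -wilsonAction ρ U :=
  (continuous_wilsonAction_of_continuous ρ hρ).neg.measurable

omit [MeasurableSpace G] [BorelSpace G] [SecondCountableTopology G] in
/-- `|−S_W^ρ| ≤ 2N·#plaq`. [folklore] -/
theorem neg_wilsonAction_bounded (hρ : Continuous ρ) :
    ∃ C : ℝ, ∀ U : GaugeConfig d L G, |(-wilsonAction ρ U)| ≤ C :=
  ⟨2 * N * Fintype.card (Plaquette d L), fun U => by
    rw [abs_neg, abs_of_nonneg (WilsonPinching.wilsonAction_nonneg ρ hρ U)]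
    exact WilsonPinching.wilsonAction_le ρ hρ U⟩

/-- The member `D[U].tilted(u·(−S_W))` of the family is the Wilson measure `μ_u`. [folklore] -/
theorem tilted_neg_wilsonAction_eq (hρ : Continuous ρ) (u : ℝ) :
    ((trivialMeasure G d L).tilted fun U => u * (-wilsonAction ρ U)) =
      wilsonMeasure (d := d) (L := L) ρ u :=
  (wilsonMeasure_eq_tilted_neg ρ hρ u).symm

/-- **READING**: `swapAcc (−S_W^ρ) D[U] a b = ∫∫ min(1, e^{(b−a)(S_W(V) − S_W(U))}) dμ_a(U) dμ_b(V)` — the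
stationary mean acceptance of the parallel-tempering swap between the Wilson measures at couplings `a`
(configuration `U`) and `b` (configuration `V`). [ours] -/
theorem wilson_swapAcc_eq (hρ : Continuous ρ) (a b : ℝ) :
    swapAcc (fun U => -wilsonAction ρ U) (trivialMeasure G d L) a b =
      ∫ p, min 1 (exp ((b - a) * (wilsonAction ρ p.2 - wilsonAction ρ p.1)))
        ∂((wilsonMeasure (d := d) (L := L) ρ a).prod (wilsonMeasure (d := d) (L := L) ρ b)) := by
  haveI : IsProbabilityMeasure (trivialMeasure G d L) := trivialMeasure_isProbabilityMeasure
  unfold swapAcc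
  rw [tilted_neg_wilsonAction_eq ρ hρ a, tilted_neg_wilsonAction_eq ρ hρ b]
  refine integral_congr_ae (ae_of_all _ fun p => ?_)
  simp only
  ring_nf

/-! ## §2 The two-sided swap acceptance law for the Wilson coupling family -/

/-- **CEILING: `swapAcc ≤ exp(−(ψ(b) − 2ψ((a+b)/2) + ψ(a)))`**, `ψ = cgf(−S_W^ρ)` under `D[U]` — the
squared Bhattacharyya coefficient of `μ_a, μ_b`. [ours] -/
theorem wilson_swapAcc_le (hρ : Continuous ρ) (a b : ℝ) :
    swapAcc (fun U => -wilsonAction ρ U) (trivialMeasure G d L) a b ≤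
      exp (-(cgf (fun U => -wilsonAction ρ U) (trivialMeasure G d L) b -
        2 * cgf (fun U => -wilsonAction ρ U) (trivialMeasure G d L) ((a + b) / 2) +
        cgf (fun U => -wilsonAction ρ U) (trivialMeasure G d L) a)) := by
  haveI : IsProbabilityMeasure (trivialMeasure G d L) := trivialMeasure_isProbabilityMeasure
  have h := swapAcc_le_exp_midpoint_gap (μ := trivialMeasure G d L) (measurable_neg_wilsonAction ρ hρ)
    (neg_wilsonAction_bounded ρ hρ) a b
  refine h.trans (le_of_eq ?_)
  congr 1
  ring

/-- **SWAP ACCEPTANCE × REWEIGHTING SECOND MOMENT ≤ 1**: with `w = dμ_{(a+b)/2}/dμ_a` the importance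
weight of the exact reweighting half-step `a → (a+b)/2`, `swapAcc(a,b) · E_{μ_a}[w²] ≤ 1` — the swap
acceptance is at most the ESS fraction `1/E[w²]` of that half-step (GEN-8's `weight_sq_integral_eq_anyGroup`).
[ours] -/
theorem wilson_swapAcc_mul_weight_sq_le_one (hρ : Continuous ρ) (a b : ℝ) :
    swapAcc (fun U => -wilsonAction ρ U) (trivialMeasure G d L) a b *
      ∫ U, (Real.exp (-((b - a) / 2 * wilsonAction ρ U)) *
        (mgf (fun U => -wilsonAction ρ U) (trivialMeasure G d L) a /
          mgf (fun U => -wilsonAction ρ U) (trivialMeasure G d L) (a + (b - a) / 2))) ^ 2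
      ∂(wilsonMeasure (d := d) (L := L) ρ a) ≤ 1 := by
  rw [weight_sq_integral_eq_anyGroup hρ a ((b - a) / 2)]
  have h1 : a + 2 * ((b - a) / 2) = b := by ring
  have h2 : a + (b - a) / 2 = (a + b) / 2 := by ring
  rw [h1, h2]
  have h := wilson_swapAcc_le (d := d) (L := L) ρ hρ a b
  calc swapAcc (fun U => -wilsonAction ρ U) (trivialMeasure G d L) a b *
        exp (cgf (fun U => -wilsonAction ρ U) (trivialMeasure G d L) b -
          2 * cgf (fun U => -wilsonAction ρ U) (trivialMeasure G d L) ((a + b) / 2) +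
          cgf (fun U => -wilsonAction ρ U) (trivialMeasure G d L) a)
      ≤ exp (-(cgf (fun U => -wilsonAction ρ U) (trivialMeasure G d L) b -
          2 * cgf (fun U => -wilsonAction ρ U) (trivialMeasure G d L) ((a + b) / 2) +
          cgf (fun U => -wilsonAction ρ U) (trivialMeasure G d L) a)) *
        exp (cgf (fun U => -wilsonAction ρ U) (trivialMeasure G d L) b -
          2 * cgf (fun U => -wilsonAction ρ U) (trivialMeasure G d L) ((a + b) / 2) +
          cgf (fun U => -wilsonAction ρ U) (trivialMeasure G d L) a) :=
        mul_le_mul_of_nonneg_right h (exp_pos _).le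
    _ = 1 := by rw [← exp_add, neg_add_cancel, exp_zero]

/-- **FLOOR (no hypothesis): `swapAcc ≥ exp(−|b−a|·√(Var_a(S_W) + Var_b(S_W) + (⟨S_W⟩_a − ⟨S_W⟩_b)²))`.**
[ours] -/
theorem wilson_swapAcc_ge (hρ : Continuous ρ) (a b : ℝ) :
    exp (-(|b - a| * sqrt (variance (wilsonAction (d := d) (L := L) ρ) (wilsonMeasure (d := d) (L := L) ρ a) +
        variance (wilsonAction (d := d) (L := L) ρ) (wilsonMeasure (d := d) (L := L) ρ b) +
        ((∫ U, wilsonAction ρ U ∂(wilsonMeasure (d := d) (L := L) ρ a)) -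
          ∫ U, wilsonAction ρ U ∂(wilsonMeasure (d := d) (L := L) ρ b)) ^ 2))) ≤
      swapAcc (fun U => -wilsonAction ρ U) (trivialMeasure G d L) a b := by
  haveI : IsProbabilityMeasure (trivialMeasure G d L) := trivialMeasure_isProbabilityMeasure
  have h := swapAcc_ge_exp_neg (μ := trivialMeasure G d L) (measurable_neg_wilsonAction ρ hρ)
    (neg_wilsonAction_bounded ρ hρ) a b
  rw [tilted_neg_wilsonAction_eq ρ hρ a, tilted_neg_wilsonAction_eq ρ hρ b, variance_fun_neg,
    variance_fun_neg, integral_neg, integral_neg] at h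
  have e : ∀ A B : ℝ, (-A - -B) ^ 2 = (A - B) ^ 2 := fun A B => by ring
  simpa only [e] using h

/-- **UNDER A SPECIFIC-HEAT FLOOR: `swapAcc ≤ exp(−m(b−a)²/4)`** whenever `a ≤ b` and
`m ≤ Var_{μ_u}(S_W^ρ)` for `u ∈ [a,b]`. [ours] -/
theorem wilson_swapAcc_le_of_floor (hρ : Continuous ρ) {a b m : ℝ} (hab : a ≤ b)
    (hm : ∀ u ∈ Icc a b, m ≤ variance (wilsonAction (d := d) (L := L) ρ) (wilsonMeasure (d := d) (L := L) ρ u)) :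
    swapAcc (fun U => -wilsonAction ρ U) (trivialMeasure G d L) a b ≤ exp (-(m * (b - a) ^ 2 / 4)) := by
  haveI : IsProbabilityMeasure (trivialMeasure G d L) := trivialMeasure_isProbabilityMeasure
  refine swapAcc_le_exp_neg_floor (μ := trivialMeasure G d L) (measurable_neg_wilsonAction ρ hρ)
    (neg_wilsonAction_bounded ρ hρ) hab fun u hu => ?_
  have h := hm u hu
  rwa [← tilted_neg_wilsonAction_eq ρ hρ u, ← variance_fun_neg] at h

/-- **UNDER A SPECIFIC-HEAT CEILING: `swapAcc ≥ exp(−((b−a)√(2M) + M(b−a)²))`** whenever `a ≤ b` and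
`Var_{μ_u}(S_W^ρ) ≤ M` for `u ∈ [a,b]`. [ours] -/
theorem wilson_swapAcc_ge_of_ceiling (hρ : Continuous ρ) {a b M : ℝ} (hab : a ≤ b)
    (hM : ∀ u ∈ Icc a b, variance (wilsonAction (d := d) (L := L) ρ) (wilsonMeasure (d := d) (L := L) ρ u) ≤ M) :
    exp (-((b - a) * sqrt (2 * M) + M * (b - a) ^ 2)) ≤
      swapAcc (fun U => -wilsonAction ρ U) (trivialMeasure G d L) a b := by
  haveI : IsProbabilityMeasure (trivialMeasure G d L) := trivialMeasure_isProbabilityMeasure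
  refine swapAcc_ge_exp_neg_ceiling (μ := trivialMeasure G d L) (measurable_neg_wilsonAction ρ hρ)
    (neg_wilsonAction_bounded ρ hρ) hab fun u hu => ?_
  have h := hM u hu
  rwa [← tilted_neg_wilsonAction_eq ρ hρ u, ← variance_fun_neg] at h

/-! ## §3 Replica-ladder laws for the Wilson action -/

/-- **LADDER NECESSITY UNDER ANY FLOOR**: a monotone coupling ladder `β` with `m ≤ Var_u(S_W)` on
`[β_0, β_K]` (`m ≥ 0`) and all adjacent swap rates `≥ α > 0` has `m(β_K − β_0)² ≤ 4K² log(1/α)`. [ours] -/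
theorem wilson_ladder_necessary (hρ : Continuous ρ) {m : ℝ} (hm0 : 0 ≤ m) (K : ℕ) (β : ℕ → ℝ)
    (hβ : Monotone β)
    (hfloor : ∀ u ∈ Icc (β 0) (β K),
      m ≤ variance (wilsonAction (d := d) (L := L) ρ) (wilsonMeasure (d := d) (L := L) ρ u))
    {α : ℝ} (hα : 0 < α)
    (hacc : ∀ j < K, α ≤ swapAcc (fun U => -wilsonAction ρ U) (trivialMeasure G d L) (β j) (β (j + 1))) :
    m * (β K - β 0) ^ 2 ≤ 4 * (K : ℝ) ^ 2 * log (1 / α) := by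
  haveI : IsProbabilityMeasure (trivialMeasure G d L) := trivialMeasure_isProbabilityMeasure
  refine ladder_necessary (μ := trivialMeasure G d L) (measurable_neg_wilsonAction ρ hρ)
    (neg_wilsonAction_bounded ρ hρ) hm0 K β hβ (fun u hu => ?_) hα hacc
  have h := hfloor u hu
  rwa [← tilted_neg_wilsonAction_eq ρ hρ u, ← variance_fun_neg] at h

/-- **LADDER SUFFICIENCY UNDER ANY CEILING**: if `Var_u(S_W) ≤ M` (`M ≥ 0`) on `[a, a+Kδ]` (`δ ≥ 0`),
`δ√M ≤ 1` and `3δ√M ≤ log(1/α)`, every adjacent swap of the uniform ladder `a + jδ` has rate `≥ α`. [ours] -/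
theorem wilson_ladder_sufficient (hρ : Continuous ρ) {a δ M α : ℝ} (hδ : 0 ≤ δ) (hM0 : 0 ≤ M) {K : ℕ}
    (hM : ∀ u ∈ Icc a (a + K * δ),
      variance (wilsonAction (d := d) (L := L) ρ) (wilsonMeasure (d := d) (L := L) ρ u) ≤ M)
    (hu1 : δ * sqrt M ≤ 1) (hu2 : 3 * (δ * sqrt M) ≤ log (1 / α)) (hα : 0 < α) :
    ∀ j < K, α ≤ swapAcc (fun U => -wilsonAction ρ U) (trivialMeasure G d L) (a + j * δ) (a + (j + 1) * δ) := by
  haveI : IsProbabilityMeasure (trivialMeasure G d L) := trivialMeasure_isProbabilityMeasure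
  refine ladder_sufficient' (μ := trivialMeasure G d L) (measurable_neg_wilsonAction ρ hρ)
    (neg_wilsonAction_bounded ρ hρ) hδ hM0 (fun u hu => ?_) hu1 hu2 hα
  have h := hM u hu
  rwa [← tilted_neg_wilsonAction_eq ρ hρ u, ← variance_fun_neg] at h

/-- **The trivial specific-heat ceiling `Var_u(S_W^ρ) ≤ (N·#plaq)²`** (`0 ≤ S_W ≤ 2N·#plaq`), every
coupling, every compact `G`. [folklore] -/
theorem wilson_variance_le_sq (hρ : Continuous ρ) (u : ℝ) :
    variance (wilsonAction (d := d) (L := L) ρ) (wilsonMeasure (d := d) (L := L) ρ u) ≤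
      ((N : ℝ) * Fintype.card (Plaquette d L)) ^ 2 := by
  haveI := isProbabilityMeasure_wilsonMeasure (d := d) (L := L) ρ hρ u
  have h := variance_le_sq_of_bounded (μ := wilsonMeasure (d := d) (L := L) ρ u) (a := 0)
    (b := 2 * N * Fintype.card (Plaquette d L)) (X := wilsonAction (d := d) (L := L) ρ)
    (ae_of_all _ fun U => ⟨WilsonPinching.wilsonAction_nonneg ρ hρ U, WilsonPinching.wilsonAction_le ρ hρ U⟩)
    (continuous_wilsonAction_of_continuous ρ hρ).measurable.aemeasurable
  calc variance (wilsonAction (d := d) (L := L) ρ) (wilsonMeasure (d := d) (L := L) ρ u)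
      ≤ ((2 * N * Fintype.card (Plaquette d L) - 0) / 2) ^ 2 := h
    _ = ((N : ℝ) * Fintype.card (Plaquette d L)) ^ 2 := by ring

/-- **`O(VOLUME)` REPLICAS ALWAYS SUFFICE, EVERY COUPLING, EVERY COMPACT GAUGE GROUP**: the uniform
ladder `a + jδ` with `δ·N·#plaq ≤ 1` and `3δ·N·#plaq ≤ log(1/α)` has every adjacent swap rate `≥ α` —
`⌈(b−a)·N·#plaq·max(1, 3/log(1/α))⌉` replicas suffice at every coupling (trivial ceiling; with the
necessity below: `√volume ≲ K ≲ volume`). [ours] -/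
theorem wilson_ladder_sufficient_allCouplings (hρ : Continuous ρ) {a δ α : ℝ} (hδ : 0 ≤ δ) {K : ℕ}
    (hu1 : δ * ((N : ℝ) * Fintype.card (Plaquette d L)) ≤ 1)
    (hu2 : 3 * (δ * ((N : ℝ) * Fintype.card (Plaquette d L))) ≤ log (1 / α)) (hα : 0 < α) :
    ∀ j < K, α ≤ swapAcc (fun U => -wilsonAction ρ U) (trivialMeasure G d L) (a + j * δ) (a + (j + 1) * δ) := by
  have hP : 0 ≤ (N : ℝ) * Fintype.card (Plaquette d L) := by positivity
  have hs : sqrt (((N : ℝ) * Fintype.card (Plaquette d L)) ^ 2) = (N : ℝ) * Fintype.card (Plaquette d L) :=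
    sqrt_sq hP
  refine wilson_ladder_sufficient (d := d) (L := L) ρ hρ hδ (sq_nonneg _) (K := K)
    (fun u _ => wilson_variance_le_sq ρ hρ u) ?_ ?_ hα
  · rwa [hs]
  · rwa [hs]

/-- **`√VOLUME` REPLICAS ARE NECESSARY AT EVERY COUPLING, EVERY COMPACT GAUGE GROUP** (unitary `ρ`,
`d ≥ 2`, `L ≥ 2`): a monotone coupling ladder inside `[−B, B]` with all adjacent swap rates `≥ α > 0`
satisfies `e^{−B·2NK(1+4K)}·⌊L/2⌋^d·Var_Haar(Re tr ρ)·(β_K − β_0)² ≤ 4K²·log(1/α)`, `K = (d+1)d²`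
(GEN-9's all-coupling variance floor). [ours] -/
theorem wilson_ladder_necessary_allCouplings (hd : 2 ≤ d) (hL : 2 ≤ L) (hρ : Continuous ρ)
    (hρu : ∀ g, ρ g ∈ Matrix.unitaryGroup (Fin N) ℂ) (K : ℕ) (β : ℕ → ℝ) (hβ : Monotone β) {B : ℝ}
    (hlo : -B ≤ β 0) (hhi : β K ≤ B) {α : ℝ} (hα : 0 < α)
    (hacc : ∀ j < K, α ≤ swapAcc (fun U => -wilsonAction ρ U) (trivialMeasure G d L) (β j) (β (j + 1))) :
    Real.exp (-(B * (2 * N * ((d + 1) * d ^ 2 : ℕ) * (1 + 4 * ((d + 1) * d ^ 2 : ℕ))))) *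
        ((L / 2) ^ d : ℕ) * variance (fun g => (ρ g).trace.re) (haarProbability G) * (β K - β 0) ^ 2 ≤
      4 * (K : ℝ) ^ 2 * log (1 / α) := by
  have hv : 0 ≤ variance (fun g => (ρ g).trace.re) (haarProbability G) := variance_nonneg _ _
  refine wilson_ladder_necessary (d := d) (L := L) ρ hρ (by positivity) K β hβ (fun u hu => ?_) hα hacc
  refine le_trans ?_ (wilson_variance_ge_allCouplings (d := d) (L := L) ρ hd hL hρ hρu u)
  have hu : |u| ≤ B := abs_le.2 ⟨by linarith [hu.1], by linarith [hu.2]⟩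
  have hc : 0 ≤ (2 * N * ((d + 1) * d ^ 2 : ℕ) * (1 + 4 * ((d + 1) * d ^ 2 : ℕ)) : ℝ) := by positivity
  gcongr

/-- **NECESSITY AT STRONG COUPLING, EVERY COMPACT GAUGE GROUP**: a monotone coupling ladder inside the
window `[−w, w]`, `w = min(r/8, v_ρ r³/512)`, with all adjacent swap rates `≥ α > 0` satisfies
**`(v_ρ·#plaq/2)·(β_K − β_0)² ≤ 4K²·log(1/α)`** — at least `(β_K − β_0)·√(v_ρ#plaq/(8 log(1/α)))`
replicas. [ours] -/
theorem wilson_ladder_necessary_strongCoupling (hρ : Continuous ρ)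
    (hρu : ∀ g, ρ g ∈ Matrix.unitaryGroup (Fin N) ℂ) (hL : 2 ≤ L) (K : ℕ) (β : ℕ → ℝ) (hβ : Monotone β)
    (hlo : -(min (1 / (4 * Real.exp 1 * max 1 (2 * (N : ℝ)) * ((3 : ℝ) ^ d * (d : ℝ) ^ 2 + 1) ^ 2) / 8)
      (variance (fun g => (ρ g).trace.re) (haarProbability G) *
        (1 / (4 * Real.exp 1 * max 1 (2 * (N : ℝ)) * ((3 : ℝ) ^ d * (d : ℝ) ^ 2 + 1) ^ 2)) ^ 3 / 512)) ≤ β 0)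
    (hhi : β K ≤
      min (1 / (4 * Real.exp 1 * max 1 (2 * (N : ℝ)) * ((3 : ℝ) ^ d * (d : ℝ) ^ 2 + 1) ^ 2) / 8)
      (variance (fun g => (ρ g).trace.re) (haarProbability G) *
        (1 / (4 * Real.exp 1 * max 1 (2 * (N : ℝ)) * ((3 : ℝ) ^ d * (d : ℝ) ^ 2 + 1) ^ 2)) ^ 3 / 512))
    {α : ℝ} (hα : 0 < α)
    (hacc : ∀ j < K, α ≤ swapAcc (fun U => -wilsonAction ρ U) (trivialMeasure G d L) (β j) (β (j + 1))) :
    variance (fun g => (ρ g).trace.re) (haarProbability G) * Fintype.card (Plaquette d L) / 2 *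
        (β K - β 0) ^ 2 ≤ 4 * (K : ℝ) ^ 2 * log (1 / α) := by
  have hm0 : 0 ≤ variance (fun g => (ρ g).trace.re) (haarProbability G) *
      Fintype.card (Plaquette d L) / 2 := by
    have : 0 ≤ variance (fun g => (ρ g).trace.re) (haarProbability G) := variance_nonneg _ _
    positivity
  refine wilson_ladder_necessary (d := d) (L := L) ρ hρ hm0 K β hβ (fun u hu => ?_) hα hacc
  refine wilson_variance_ge_half_anyGroup ρ hρ hρu hL u ?_
  rw [abs_le]
  exact ⟨by linarith [hu.1], by linarith [hu.2]⟩

/-- **SUFFICIENCY AT STRONG COUPLING, EVERY COMPACT GAUGE GROUP**: inside `[−r/4, r/4]` (where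
`Var_u(S_W) ≤ 32#plaq/r²`) the uniform ladder `a + jδ`, `j ≤ K`, with `δ√(32#plaq/r²) ≤ 1` and
`3δ√(32#plaq/r²) ≤ log(1/α)` has every adjacent swap rate `≥ α`: `⌈(b−a)·√(32#plaq)/r · max(1, 3/log(1/α))⌉`
replicas SUFFICE — with the necessity above, `Θ((b−a)√#plaq)` replicas. [ours] -/
theorem wilson_ladder_sufficient_strongCoupling (hρ : Continuous ρ)
    (hρu : ∀ g, ρ g ∈ Matrix.unitaryGroup (Fin N) ℂ) {a δ α : ℝ} (hδ : 0 ≤ δ) {K : ℕ}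
    (hlo : -(1 / (4 * Real.exp 1 * max 1 (2 * (N : ℝ)) * ((3 : ℝ) ^ d * (d : ℝ) ^ 2 + 1) ^ 2) / 4) ≤ a)
    (hhi : a + K * δ ≤
      1 / (4 * Real.exp 1 * max 1 (2 * (N : ℝ)) * ((3 : ℝ) ^ d * (d : ℝ) ^ 2 + 1) ^ 2) / 4)
    (hu1 : δ * sqrt (32 * Fintype.card (Plaquette d L) /
      (1 / (4 * Real.exp 1 * max 1 (2 * (N : ℝ)) * ((3 : ℝ) ^ d * (d : ℝ) ^ 2 + 1) ^ 2)) ^ 2) ≤ 1)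
    (hu2 : 3 * (δ * sqrt (32 * Fintype.card (Plaquette d L) /
      (1 / (4 * Real.exp 1 * max 1 (2 * (N : ℝ)) * ((3 : ℝ) ^ d * (d : ℝ) ^ 2 + 1) ^ 2)) ^ 2)) ≤ log (1 / α))
    (hα : 0 < α) :
    ∀ j < K, α ≤ swapAcc (fun U => -wilsonAction ρ U) (trivialMeasure G d L) (a + j * δ) (a + (j + 1) * δ) := by
  have hr0 := kpRadiusGroup_pos d N
  refine wilson_ladder_sufficient (d := d) (L := L) ρ hρ hδ (by positivity) (fun u hu => ?_) hu1 hu2 hα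
  refine wilson_variance_le_anyGroup (d := d) (L := L) ρ hρ hρu u ?_
  rw [abs_lt]
  exact ⟨by linarith [hu.1], by linarith [hu.2]⟩

end AnyGroup

/-! ## §4 `SU(n)`: `√volume` replicas at every coupling with polynomial constants -/

section SUN

variable {d n : ℕ}

/-- **`SU(n)`, `n ≥ 2`, `d ≥ 2`: one `c = c(n,d) > 0` such that for every `L ≥ 2`, every monotone coupling
ladder `0 ≤ β_0 ≤ … ≤ β_K` with all adjacent swap rates `≥ α > 0`:
`c·#plaq/(1 + β_K²)·(β_K − β_0)² ≤ 4K²·log(1/α)`** — `K ≥ (β_K − β_0)·√(c·#plaq)/(2√((1+β_K²)log(1/α)))`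
replicas, POLYNOMIAL in the coupling, uniformly in the volume (item 129's all-coupling floor). [ours] -/
theorem wilson_ladder_necessary_sun (hn : 2 ≤ n) (hd : 2 ≤ d) :
    ∃ c : ℝ, 0 < c ∧ ∀ (L : ℕ) [NeZero L], 2 ≤ L → ∀ (K : ℕ) (β : ℕ → ℝ), Monotone β → 0 ≤ β 0 →
      ∀ α : ℝ, 0 < α →
      (∀ j < K, α ≤ swapAcc (fun U => -wilsonAction (StrongCoupling.defRep n) U)
        (trivialMeasure (Matrix.specialUnitaryGroup (Fin n) ℂ) d L) (β j) (β (j + 1))) →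
      c * Fintype.card (Plaquette d L) / (1 + β K ^ 2) * (β K - β 0) ^ 2 ≤
        4 * (K : ℝ) ^ 2 * log (1 / α) := by
  obtain ⟨c, hc, h⟩ := wilson_variance_floor_allCouplings_rep (d := d) (n := n) hn hd
  refine ⟨c, hc, fun L _ hL K β hβ h0 α hα hacc => ?_⟩
  have hρ : Continuous (StrongCoupling.defRep n) := continuous_subtype_val
  have hm0 : 0 ≤ c * Fintype.card (Plaquette d L) / (1 + β K ^ 2) := by positivity
  refine wilson_ladder_necessary (d := d) (L := L) (StrongCoupling.defRep n) hρ hm0 K β hβ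
    (fun u hu => ?_) hα hacc
  have hu0 : 0 ≤ u := h0.trans hu.1
  refine le_trans ?_ (h L hL u hu0)
  have hP : 0 ≤ c * Fintype.card (Plaquette d L) := by positivity
  have h1 : 1 + u ^ 2 ≤ 1 + β K ^ 2 := by nlinarith [hu.2, hu0]
  exact div_le_div_of_nonneg_left hP (by positivity) h1

end SUN

end Summit.Ventures.LatticeQCDFlow.TrivializingMaps

end
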